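import Summits.BirchSwinnertonDyer.BirchSwinnertonDyer.Theorems.SignedLowerHalvesKobayashiMainConjectureSmallImageCMTransferRecordsA
import HarnessLib

/-!
# Route `SignedLowerHalves`, crux `KobayashiMainConjectureSmallImage` (item stmt-BirchSwinnertonDyer-19002) —
# the CM-congruence transfer line (L4-CM), μ-BINDER records part 18: `475983d1 @ 5` from the RANK-1 CM partner
# `y² + y = x³ + 72` = the minimal model `[0,0,1,0,72]` of `y² = x³ + 4624` (conductor `7803`), with that partner's kernel data
# (cell `bsd-ssimc`, seat `bsd-ssimc-k3-c4`: written gen 2, released gen 3 — planner condition D16-9 (c) «held until its partner's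
# minimal model is re-run» DISCHARGED by kit j253591: BOTH engines re-run ON THE MINIMAL MODEL `[0,0,1,0,72]`)

HONEST FRAMING: as in parts 01–12 — CONDITIONAL on the OPEN binder `CorpuzLei2025_signedMainConjecture_transfer_OPEN` (Corpuz–Lei
2025, UNREFEREED preprint; hypothesis `hCL`), on PUBLISHED results BY NAME (`hPR`, `h5`, `h3`, Fisher 2012 Thm. 13.2 `hF`) and on ONE
DISPLAYED NON-KERNEL μ-binder `hμ'` (two-engine certificate kit j253591 ON THE MINIMAL MODEL `[0,0,1,0,72]`: engine A PARI 2.17.2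
`ellglobalred` ⇒ conductor `7803`, model minimal (change `[1,0,0,0]`), `a_5 = 0`, analytic rank `1`, `ellpadiclambdamu(E',5) = [[1,1],[0,0]]`;
engine B = the cell's PARI-free modular-symbol engine (sha256-pinned): Mazur–Tate layers even-Pollack-index top `n = 3` μ = 0 λ−q = 1, odd top
`n = 2` μ = 0 λ−q = 1, `symbols_ok`, 25 Hecke-relation checks / 0 failures; the isomorphic model `[0,0,0,0,4624]` of kit j251201 run alongside
as control gives IDENTICAL readings, Néron periods in ratio `2` = a `5`-unit). The Hesse certificate was RE-DERIVED on the minimal model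
(the covariants are weighted-homogeneous: `(λ:μ) = (816:1)`, `u = 7511111368704` on `[0,0,0,0,4624]` become `(204:1)`,
`u = 3667534848` on `[0,0,1,0,72]`; seat folder `work/hesse_cert.py`). Kernel-decided: the partner's ellipticity, minimality, point
count and CM; `5 ∤ Δ` on both; `#Ẽ(𝔽_5) = 6`; the window curve's model enters as instance binders (its |Δ| ≈ 8.8·10³² exceeds the
bound of the tree's bounded Kraus criterion). Per pair; item 4 stays OPEN; nothing booked; BSD is not proved by any of this.

References: [CorpuzLei2025] Thms 1–3; [PollackRubin2004] Thm. (p. 448); [Fisher2012Hessian] §8, Thm. 13.2; [SilvermanAEC2009] III §1,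
VII.1, App. C §11; [Cremona2006] Table 1 (label 475983d1).
-/

set_option autoImplicit false
set_option linter.dupNamespace false

noncomputable section

open scoped Classical MatrixGroups ModularForm

open CongruenceSubgroup WeierstrassCurve Literature.NumberTheory.EllipticCurves
  Literature.NumberTheory.EllipticCurves.ModularForms
  Literature.NumberTheory.EllipticCurves.Kobayashi2003 ZpExtension
  Literature.NumberTheory.EllipticCurves.GreenbergVatsal2000
  Literature.NumberTheory.EllipticCurves.Rank1Residual
  Literature.NumberTheory.EllipticCurves.Rank1Residual.Typed
  Literature.NumberTheory.EllipticCurves.Rank1Residual.X11RankOneCertificates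
  Literature.NumberTheory.EllipticCurves.Fisher2012
  Summit.BirchSwinnertonDyer.BirchSwinnertonDyer.Rank1Residual.IntModel
  Summit.BirchSwinnertonDyer.BirchSwinnertonDyer.Rank1Residual.X11RankOne
  Summit.BirchSwinnertonDyer.Rank1Residual.X11b
  Summit.BirchSwinnertonDyer.Rank1Residual.X9
  Summit.BirchSwinnertonDyer.Rank1Residual.X1
  Summit.BirchSwinnertonDyer.Rank1Residual.Supersingular

namespace Summit.BirchSwinnertonDyer.BirchSwinnertonDyer.Theorems

/-- `#{Ẽ'(𝔽_5)} = 6` for the CM partner `[0,0,1,0,72] : y² + y = x³ + 72` (`j = 0`; minimal model of `y² = x³ + 4624`, conductor `7803`;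
`a_5 = 0`: good SUPERSINGULAR; kernel count). [folklore] -/
theorem card_cm72a3_5 :
    Nat.card (((⟨0, 0, 1, 0, 72⟩ : WeierstrassCurve ℤ).map
      (Int.castRingHom (ZMod 5))).toAffine.Point) = 6 := by
  rw [@WeierstrassCurve.natCard_point_eq_one_add_card (ZMod 5) (@ZMod.instField 5 ⟨by norm_num⟩) _ _ _
    (by decide +kernel), @card_sol_eq_sum_euler (ZMod 5) (@ZMod.instField 5 ⟨by norm_num⟩) _ _
    (by rw [ZMod.ringChar_zmod_n]; decide), ZMod.card]
  decide +kernel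

/-- `[0,0,1,0,72] : y² + y = x³ + 72` is an elliptic curve (`Δ ≠ 0`, kernel). [folklore] -/
theorem isElliptic_cm72a3 : (⟨0, 0, 1, 0, 72⟩ : WeierstrassCurve ℚ).IsElliptic :=
  isElliptic_of_discOf_ne_zero 0 0 1 0 72 (by decide +kernel)

/-- `[0,0,1,0,72]` is globally minimal (Kraus' bounded criterion, kernel). [cite: SilvermanAEC2009, VII.1 Remark 1.1] -/
theorem isGloballyMinimal_cm72a3 : (⟨0, 0, 1, 0, 72⟩ : WeierstrassCurve ℚ).IsGloballyMinimal :=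
  isGloballyMinimal_of_krausCriterion_bounded₂ 0 0 1 0 72 (by decide +kernel) (by decide +kernel)
    (by decide +kernel)

/-- `[0,0,1,0,72]` has CM (`j = 0 ∈` the thirteen CM values), for any globally minimal `A` with this integral model.
[cite: SilvermanAEC2009, App. C §11] -/
theorem hasCM_cm72a3 {A : WeierstrassCurve ℚ} [A.IsElliptic] [A.IsGloballyMinimal]
    (hIA : integralModelInt A = ⟨0, 0, 1, 0, 72⟩) : A.HasCM :=
  (hasCM_iff_j_mem_holds A).mpr (by rw [j_eq_of_intModel 0 0 1 0 72 hIA]; decide +kernel)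

/-- `#{Ẽ(𝔽_5)} = 6` for the Cremona model of `475983d1` (`a_5 = 0`: good SUPERSINGULAR; kernel count).
[cite: Cremona2006, Table 1 (Cremona label 475983d1)] -/
theorem card_c475983d1_5 :
    Nat.card (((⟨0, 0, 1, -20807635860, -1837159729545625⟩ : WeierstrassCurve ℤ).map
      (Int.castRingHom (ZMod 5))).toAffine.Point) = 6 := by
  rw [@WeierstrassCurve.natCard_point_eq_one_add_card (ZMod 5) (@ZMod.instField 5 ⟨by norm_num⟩) _ _ _
    (by decide +kernel), @card_sol_eq_sum_euler (ZMod 5) (@ZMod.instField 5 ⟨by norm_num⟩) _ _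
    (by rw [ZMod.ringChar_zmod_n]; decide), ZMod.card]
  decide +kernel

/-- **Kobayashi's ± main conjecture, BOTH signs, for `475983d1 @ 5`** (Cremona model `[0, 0, 1, -20807635860, -1837159729545625]`, `N = 475983 = 3³·17²·61`,
`r_an = 0`; item-4 pair: X7, `a_5 = 0`, image `5Nn`) **by CM-congruence transfer from the RANK-1 CM partner
`E' =` `[0,0,1,0,72] : y² + y = x³ + 72` (`j = 0`; the minimal model of `y² = x³ + 4624`) (conductor `7803`), MODULO the OPEN binder `hCL` (Corpuz–Lei 2025, PRE) AND the displayed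
`μ`-BINDER `hμ'`** (unit content of `L_p^±(E')` — NOT a kernel fact; certificate: kit j253591, both engines ON THIS MINIMAL MODEL (planner condition D16-9 (c); kit j251201's readings on the isomorphic `[0,0,0,0,4624]` are identical) — engine A PARI `ellpadiclambdamu(E',5) = [[1, 1], [0, 0]]`; engine B (cell's PARI-free modular-symbol engine) Mazur–Tate layers: even-Pollack-index top n=3 μ=0 λ−q=1, odd top n=2 μ=0 λ−q=1 — TWO engines agree μ^± = 0; partner conductor 7803, analytic rank 1). `E ≅_ℚ` the member `(λ:μ) = (204:1)` of `X_{E'}(5)`, `u = 3667534848` (`fiveCongruent_of_hesseCertificate`, modulo Fisher 2012 Thm. 13.2 `hF`);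
covariant identities by `norm_num`. BY NAME: `hPR`, `h5`, `h3`, `hF`. Kernel-decided (models as instance binders): `5 ∤ Δ` (both),
`#Ẽ(𝔽_5) = #Ẽ'(𝔽_5) = 6`, CM of `E'`. Per pair; item 4 stays OPEN; nothing booked.
[claim: CorpuzLei2025, status: under-review] [cite: PollackRubin2004, Theorem (p. 448) = Thm. 7.3]
[cite: Fisher2012Hessian, Thm. 13.2 (n = 5)] [cite: Cremona2006, Table 1 (Cremona label 475983d1)] -/
theorem kobayashiMainConjecture_c475983d1_5_of_mu_of_transfer_OPEN
    (hCL : CorpuzLei2025_signedMainConjecture_transfer_OPEN)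
    (hPR : PollackRubin2004.mainTheorem_signedCharIdeal_eq_of_cm)
    (h5 : realPeriodRat_eq_unit_mul_plusPeriod) (h3 : realPeriodRat_eq_unit_mul_plusPeriod_three)
    (hF : thm132_fiveCongruent_hessePencil)
    (W A : WeierstrassCurve ℚ) [W.IsElliptic] [W.IsGloballyMinimal] [A.IsElliptic] [A.IsGloballyMinimal]
    [Fact (Nat.Prime 5)] (hW : W = ⟨0, 0, 1, -20807635860, -1837159729545625⟩) (hA : A = ⟨0, 0, 1, 0, 72⟩)
    (hμ' : ∀ [NeZero (A.conductorNorm ℤ)] (f' : CuspForm (Gamma0 (A.conductorNorm ℤ)) 2),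
      IsNewformOf A f' → ∀ (Lplus Lminus : IwasawaAlgebra 5), IsPollackPair f' 5 Lplus Lminus →
      ∀ ε : ℤˣ, HasUnitContent (kobayashiL ε Lplus Lminus)) (ε : ℤˣ) :
    KobayashiMainConjecture W 5 ε := by
  have hIW : integralModelInt W = ⟨0, 0, 1, -20807635860, -1837159729545625⟩ :=
    integralModelInt_eq_of_map_eq _ (by rw [hW]; ext <;> simp [WeierstrassCurve.map])
  have hIA : integralModelInt A = ⟨0, 0, 1, 0, 72⟩ :=
    integralModelInt_eq_of_map_eq _ (by rw [hA]; ext <;> simp [WeierstrassCurve.map])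
  have hΔ : (⟨0, 0, 1, -20807635860, -1837159729545625⟩ : WeierstrassCurve ℤ).Δ = discOf [0, 0, 1, -20807635860, -1837159729545625] :=
    intCurve_Δ 0 0 1 (-20807635860) (-1837159729545625)
  have hΔA : (⟨0, 0, 1, 0, 72⟩ : WeierstrassCurve ℤ).Δ = discOf [0, 0, 1, 0, 72] :=
    intCurve_Δ 0 0 1 0 72
  have hgood : W.HasGoodReductionAtPrime 5 :=
    hasGoodReductionAtPrime_of_not_dvd W 5 (by rw [minimalDiscriminantInt_eq hIW, hΔ]; decide +kernel)
  have hgoodA : A.HasGoodReductionAtPrime 5 :=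
    hasGoodReductionAtPrime_of_not_dvd A 5 (by rw [minimalDiscriminantInt_eq hIA, hΔA]; decide +kernel)
  have hap : W.frobeniusTrace 5 = 0 := by rw [frobeniusTrace_eq hIW card_c475983d1_5]; norm_num
  have hapA : A.frobeniusTrace 5 = 0 := by rw [frobeniusTrace_eq hIA card_cm72a3_5]; norm_num
  have hc4 : W.c₄ = (998766521280 : ℚ) := by
    subst hW; norm_num [WeierstrassCurve.c₄, WeierstrassCurve.b₂, WeierstrassCurve.b₄]
  have hc6 : W.c₆ = (1587306006327419784 : ℚ) := by
    subst hW; norm_num [WeierstrassCurve.c₆, WeierstrassCurve.b₂, WeierstrassCurve.b₄, WeierstrassCurve.b₆]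
  have hc4A : A.c₄ = (0 : ℚ) := by
    subst hA; norm_num [WeierstrassCurve.c₄, WeierstrassCurve.b₂, WeierstrassCurve.b₄]
  have hc6A : A.c₆ = (-62424 : ℚ) := by
    subst hA; norm_num [WeierstrassCurve.c₆, WeierstrassCurve.b₂, WeierstrassCurve.b₄, WeierstrassCurve.b₆]
  have hiso := fiveCongruent_of_hesseCertificate hF A W (204 : ℚ) 1 (3667534848 : ℚ)
    (by norm_num) (by rw [hc4A, hc6A, hc4, eval_hesseC4]; norm_num)
    (by rw [hc4A, hc6A, hc6, eval_hesseC6]; norm_num)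
  exact kobayashiMainConjecture_of_cmPartner_of_transfer_OPEN W A 5 hCL hPR h5 h3 (by norm_num) hgood hap
    (hasCM_cm72a3 hIA) ⟨hgoodA, by rw [hapA]; exact dvd_zero _⟩ hapA hiso hμ' ε

end Summit.BirchSwinnertonDyer.BirchSwinnertonDyer.Theorems

end
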